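import Summits.Ventures.CertifiedManyBodySolver.Downfold.BoxReadPinnedPairTPrime
import Summits.Ventures.CertifiedManyBodySolver.Rows.DopedTLCorrPinnedPairU
import Summits.Ventures.CertifiedManyBodySolver.Rows.DopedTLCorrBundleWN
import HarnessLib

/-!
# The `t′`-PINNED PAIR law, CHORD-WINDOW edition: PAIR ⇒ the bundle row whose window FUNCTIONS lie under the chords of the two vertex windows,
# with the rhs-covariance constant `d` (`TPrimePinnedPairRowWN.bundleWN_chord` + `_vertex` / `_vertex'` / `_interior` / `_interior'`), and the two
# solver-free edges between the constant-literal bundle shape `TPrimeBundleOrbitLowerRowWN` and the window-function bundle shape `SquareTTPrimeBundleOrbitLowerRowWN`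

Venture CertifiedManyBodySolver; cell `hubbard-obs`, D-0154 (1)(C) COVERAGE Hg-1201; seat `hubbard-cov-hg1201-box-1` (g3, lineage desk; captain
hubbard-cov-hg1201-plan-1 g3 WORD 2026-08-28T23:55:44Z «(b) draft the chord law as a NEW sibling file next to p662147, by name»; captain hubbard-cov-la214-plan-1 g3
PRE-CLEARANCE 23:57:33Z). SIBLINGS, cited BY IMPORT, nothing restated: hubbard-cov-ndnio2-box-1's `Downfold/BoxReadPinnedPairTPrime.lean` (p662147: the SHAPE
`TPrimePinnedPairRowWN` and the CONSTANT-LITERAL law `TPrimePinnedPairRowWN.bundleWN`, whose proof this file follows line by line), hubbard-cov-la214-unc-2's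
`tPrimePair_vertexFloor_le` (`Downfold/TPrimePinnedPairRow.lean`), this seat's `pinnedPair_segFloor_le` (`Rows/DopedTLCorrPinnedPairU.lean`, p660744) and the target shape
`SquareTTPrimeBundleOrbitLowerRowWN` (`Rows/DopedTLCorrBundleWN.lean`, p625626).

WHY. The three Hg-1201 K2 («PatchBottom») claim nodes — `cert_hg1201_pinB_tpseg_j310371_wn` (p643728, stmt-Ventures-26187), `cert_hg1201_pinBm19_tpseg_j311436_wn` (p646933,
27756), `cert_hg1201_pinBp10_tpseg_j317048_wn` (p666484, 27105) — are `boxdual 0.4.5` pinned-pair READS on a `t′`-segment `[s_A, s_B] × {U}` typed as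
`SquareTTPrimeBundleOrbitLowerRowWN U U s_A s_B flo cap F sl_A sl_B n₀ univ (box 2 7) X₀` with a `t′`-AFFINE cap FUNCTION: the chord through the two vertex programs'
own cap literals `c_A < c_B` (reader `cuts[0].rhs_override.coeffs`). The landed law `TPrimePinnedPairRowWN.bundleWN` takes CONSTANT bundle literals `hi ≤ c_A, c_B`,
`fl_A, fl_B ≤ lo` — no instance of it yields those nodes as booked (hubbard-obs STATUS box-1 g3 DATA «G1»). THIS FILE is the chord edition:

* §1 **`TPrimePinnedPairRowWN.bundleWN_chord`**: PAIR + `0 ≤ U`, `s_A < s_B`, `κ ≥ 0`, window FUNCTIONS `flo cap : ℝ → ℝ → ℝ` under the DIVISION-FREE chords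
  `(s_B − s_A)·cap U s ≤ (s_B − s)·c_A + (s − s_A)·c_B` and `(s_B − s)·fl_A + (s − s_A)·fl_B ≤ (s_B − s_A)·flo U s` on `[s_A, s_B]`, ANY `L` with
  `1.6211390·(s_B − s_A)·|(κ_A − κ_A′) − (κ_B − κ_B′)| − d ≤ L` (two sign cases, decidable on literals), `d = (κ_B − κ_A)(c_B − c_A) − (κ_B′ − κ_A′)(fl_B − fl_A)`
  (the reader's rhs covariance: `Σ_v w_v κ_v c_v = κ̄·chord(s) + w(1 − w)·Δκ_cap·Δc`, likewise for the floors), and ANY slot `F ≤ (1 − w)β_A + wβ_B − w(1 − w)L` on `[0, 1]`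
  ⟹ `SquareTTPrimeBundleOrbitLowerRowWN U U s_A s_B flo cap F sl_A sl_B n₀ univ (box 2 7) X₀`. Proof = `bundleWN`'s, with step (1) «multipliers × window slacks ≥ 0»
  done on the COMBINED rows: `(1 − w)κ_A(c_A − e_A) + wκ_B(c_B − e_B) = κ̄(c̄ − e) + w(1 − w)Δκ_capΔc + (K₂ cross term)`, `κ̄ ≥ 0`, `e ≤ cap U s ≤ c̄`;
* §2 corollaries with rational side goals: `_chord_vertex` / `_chord_vertex'` (`0 ≤ L`, `β_v + L ≤ β_u`, `F ≤ β_v`), `_chord_interior` / `_chord_interior'` (`0 < L`,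
  completed square);
* §3 edges (the «G2» of the DATA line): `SquareTTPrimeBundleOrbitLowerRowWN U U … (const lo) (const hi) … univ (box 2 7) X₀ ↔ TPrimeBundleOrbitLowerRowWN U … lo hi … (fun _ ↦ X₀)`,
  so the chord law also serves the constant-window consumers and `bundleWN` is its `lo/hi` instance.

HONEST FRAMING: solver-free THEOREMS between objects already in the tree; the pair shape remains a CLAIM about states justified OUTSIDE Lean (two certsdp-cert/0
certificates + `D₄`/translation averaging + the pinfold verdict) — NOT a soundness theorem for the reduced moment program; nothing is asserted here: no `def`, no node,
no number of record, no registry row, word, margin or hold changes; every Hg-1201 / La214 / NdNiO₂ item stays exactly as it is (pen-HELD «closed modulo claim nodes»,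
never ‹proved›). One-sided stiffness CEILINGS of CONTROL / CALIBRATION class (xx1) on SCREENING-GRADE downfolded boxes; a ceiling never speaks to the presence or
absence of superconductivity, `ρ_s = 0`, `T_c`, pairing or phase; columns certified separately — no pressure sentence; nothing about HgBa₂CuO₄₊δ, La₂CuO₄ or NdNiO₂
samples; no item, rung leaf or summit statement is proved here. Zero compute.

References: S. Boyd, L. Vandenberghe, *Convex Optimization* (2004) §5.9 [BoydVandenberghe2004]; T. Koma, H. Tasaki, J. Stat. Phys. 76 (1994) 745, §1
[KomaTasaki1994]; E. H. Lieb, M. Loss, Duke Math. J. 71 (1993) 337, §8 Thm. 8.2 [LiebLoss1993]; D. P. Bertsekas, *Nonlinear Programming*, 2nd ed. (1999),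
Prop. 5.1.3 [Bertsekas1999NonlinearProgramming].
-/

noncomputable section

namespace Summit.Ventures.CertifiedManyBodySolver.Downfold

open Set Filter Topology
open Literature.MathematicalPhysics.QuantumLattice Literature.MathematicalPhysics.QuantumLattice.ThermodynamicLimit
open Literature.MathematicalPhysics.QuantumLattice.InfVolFermionState
open Literature.Probability.LatticeModels
open Matrix HubbardWave0
open scoped BigOperators ComplexOrder

/-! ## §1 PAIR ⇒ window-function bundle row under the chords (the covariance law with `d`) -/

section Law
variable {U sA sB : ℝ} {cA cB flA flB βA κA κA' slA βB κB κB' slB n₀ : ℚ}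
  {X₀ : FermionOp (Literature.Probability.LatticeModels.box 2 7)}

/-- **THE BOXDUAL COVARIANCE LAW, CHORD-WINDOW EDITION (pinned `t′`-pair ⇒ density-affine bundle row with window FUNCTIONS).** From the PAIR shape, `0 ≤ U`,
`s_A < s_B`, non-negative window multipliers, bundle window functions under the vertex chords (division-free: `(s_B − s_A)·cap U s ≤ (s_B − s)c_A + (s − s_A)c_B`,
`(s_B − s)fl_A + (s − s_A)fl_B ≤ (s_B − s_A)·flo U s` on `[s_A, s_B]`), any `L` dominating `1.6211390·(s_B − s_A)·|(κ_A − κ_A') − (κ_B − κ_B')| − d` with the rhs covariance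
`d = (κ_B − κ_A)(c_B − c_A) − (κ_B' − κ_A')(fl_B − fl_A)` (two sign cases `hL₁`/`hL₂`), and any slot `F` under `(1 − w)β_A + wβ_B − w(1 − w)L` on `[0, 1]`:
`SquareTTPrimeBundleOrbitLowerRowWN U U s_A s_B flo cap F sl_A sl_B n₀ univ Λ₇ X₀`. [cite: BoydVandenberghe2004, §5.9] [cite: KomaTasaki1994, §1]
[cite: LiebLoss1993, §8, Theorem 8.2] -/
theorem TPrimePinnedPairRowWN.bundleWN_chord
    (h : TPrimePinnedPairRowWN U sA sB cA cB flA flB βA κA κA' slA βB κB κB' slB n₀ X₀)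
    (hU : 0 ≤ U) (hAB : sA < sB) (hκA : 0 ≤ κA) (hκA' : 0 ≤ κA') (hκB : 0 ≤ κB) (hκB' : 0 ≤ κB')
    {flo cap : ℝ → ℝ → ℝ}
    (hcap : ∀ s ∈ Set.Icc sA sB, (sB - sA) * cap U s ≤ (sB - s) * ((cA : ℚ) : ℝ) + (s - sA) * ((cB : ℚ) : ℝ))
    (hflo : ∀ s ∈ Set.Icc sA sB, (sB - s) * ((flA : ℚ) : ℝ) + (s - sA) * ((flB : ℚ) : ℝ) ≤ (sB - sA) * flo U s)
    {F L : ℚ}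
    (hL₁ : (1.6211390 : ℝ) * (sB - sA) * (((κA - κA' - (κB - κB') : ℚ)) : ℝ) -
      ((((κB - κA) * (cB - cA) - (κB' - κA') * (flB - flA) : ℚ)) : ℝ) ≤ ((L : ℚ) : ℝ))
    (hL₂ : (1.6211390 : ℝ) * (sB - sA) * -(((κA - κA' - (κB - κB') : ℚ)) : ℝ) -
      ((((κB - κA) * (cB - cA) - (κB' - κA') * (flB - flA) : ℚ)) : ℝ) ≤ ((L : ℚ) : ℝ))
    (hF : ∀ w ∈ Set.Icc (0 : ℝ) 1, ((F : ℚ) : ℝ) ≤ (1 - w) * ((βA : ℚ) : ℝ) + w * ((βB : ℚ) : ℝ) - w * (1 - w) * ((L : ℚ) : ℝ)) :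
    SquareTTPrimeBundleOrbitLowerRowWN U U sA sB flo cap F slA slB n₀ Finset.univ (Literature.Probability.LatticeModels.box 2 7) X₀ := by
  have hL : (1.6211390 : ℝ) * (sB - sA) * |(((κA - κA' - (κB - κB') : ℚ)) : ℝ)| -
      ((((κB - κA) * (cB - cA) - (κB' - κA') * (flB - flA) : ℚ)) : ℝ) ≤ ((L : ℚ) : ℝ) := by
    rcases le_total 0 ((((κA - κA' - (κB - κB') : ℚ)) : ℝ)) with hD | hD
    · rwa [abs_of_nonneg hD]
    · rwa [abs_of_nonpos hD]
  intro U' hU' s hs x hx0 hx2 ω Ls ψ hLs hψ h1 hω hlo hhi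
  obtain rfl : U' = U := le_antisymm hU'.2 hU'.1
  obtain ⟨E₀, E₁, hP⟩ := h
  obtain ⟨hE, hVA, hVB⟩ := hP s hs x hx0 hx2 ω Ls ψ hLs hψ h1 hω
  dsimp only [tPrimeObjOrbitMean] at hVA hVB
  -- the kinematic `K₂` row and the anchor energies of `ω`
  have hN : ∀ j, IsNParticle (rectN x (Ls j)) (ψ (Ls j)) := fun j =>
    ((mem_szSector_iff _ _ _).1 (hψ j).1).1
  have hK : |ω.meanEnergy (hubbardTTPrimeFermionInteraction 0 1 0) 1| ≤ (1.6211390 : ℝ) :=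
    hω.abs_meanEnergy_diagHop_le_decimal hx0 hx2 hLs hN h1
  have hGS : ω.meanEnergy (hubbardTTPrimeFermionInteraction 1 s U') 1 = energyDensityTT' 1 s U' x :=
    hω.meanEnergy_hubbardTTPrime_eq_energyDensityTT' 1 s hU hx0 hx2 hLs hψ h1
  have hEA : ω.meanEnergy (hubbardTTPrimeFermionInteraction 1 sA U') 1 =
      energyDensityTT' 1 s U' x + (sA - s) * ω.meanEnergy (hubbardTTPrimeFermionInteraction 0 1 0) 1 := by
    rw [ω.meanEnergy_hubbardTTPrime_affine 1 s U' sA U', hGS]; ring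
  have hEB : ω.meanEnergy (hubbardTTPrimeFermionInteraction 1 sB U') 1 =
      energyDensityTT' 1 s U' x + (sB - s) * ω.meanEnergy (hubbardTTPrimeFermionInteraction 0 1 0) 1 := by
    rw [ω.meanEnergy_hubbardTTPrime_affine 1 s U' sB U', hGS]; ring
  rw [hEA] at hVA
  rw [hEB] at hVB
  -- the chords at `s`
  have hcs := hcap s hs
  have hfs := hflo s hs
  -- plain real names for the state functionals and the window functions
  generalize hKdef : ω.meanEnergy (hubbardTTPrimeFermionInteraction 0 1 0) 1 = K at hK hVA hVB
  generalize hedef : energyDensityTT' 1 s U' x = e at hlo hhi hVA hVB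
  generalize hcpdef : cap U' s = cp at hhi hcs
  generalize hfldef : flo U' s = fv at hlo hfs
  generalize hXdef : ((Finset.univ : Finset (DihedralGroup 4)).card : ℝ)⁻¹ *
      ∑ g ∈ (Finset.univ : Finset (DihedralGroup 4)),
        (ω.expect (d4ShiftSet g 0 (Literature.Probability.LatticeModels.box 2 7))
          (fermionEmbed (PolySite.d4Emb g 0 (Literature.Probability.LatticeModels.box 2 7)) X₀)).re = Xbar at hVA hVB ⊢
  generalize hE₀def : E₀ ω = a₀ at hE hVA hVB
  generalize hE₁def : E₁ ω = a₁ at hE hVA hVB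
  -- the barycentric coordinate of `s`
  have hΔ : 0 < sB - sA := sub_pos.2 hAB
  obtain ⟨w, hw0, hw1, hsw⟩ : ∃ w : ℝ, 0 ≤ w ∧ w ≤ 1 ∧ s - sA = w * (sB - sA) :=
    ⟨(s - sA) / (sB - sA), div_nonneg (sub_nonneg.2 hs.1) hΔ.le, (div_le_one hΔ).2 (by linarith [hs.2]),
      (div_mul_cancel₀ _ (ne_of_gt hΔ)).symm⟩
  have h1w : 0 ≤ 1 - w := sub_nonneg.2 hw1
  have hsA : sA - s = -(w * (sB - sA)) := by linarith
  have hsB : sB - s = (1 - w) * (sB - sA) := by linarith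
  rw [hsA] at hVA
  rw [hsB] at hVB
  -- the chords in barycentric form: `cap ≤ (1-w) cA + w cB`, `(1-w) flA + w flB ≤ flo`
  rw [hsB, hsw] at hcs hfs
  have hcbar : cp ≤ (1 - w) * ((cA : ℚ) : ℝ) + w * ((cB : ℚ) : ℝ) := by
    have e1 : (1 - w) * (sB - sA) * ((cA : ℚ) : ℝ) + w * (sB - sA) * ((cB : ℚ) : ℝ) =
        (sB - sA) * ((1 - w) * ((cA : ℚ) : ℝ) + w * ((cB : ℚ) : ℝ)) := by ring
    rw [e1] at hcs
    exact le_of_mul_le_mul_left hcs hΔ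
  have hfbar : (1 - w) * ((flA : ℚ) : ℝ) + w * ((flB : ℚ) : ℝ) ≤ fv := by
    have e1 : (1 - w) * (sB - sA) * ((flA : ℚ) : ℝ) + w * (sB - sA) * ((flB : ℚ) : ℝ) =
        (sB - sA) * ((1 - w) * ((flA : ℚ) : ℝ) + w * ((flB : ℚ) : ℝ)) := by ring
    rw [e1] at hfs
    exact le_of_mul_le_mul_left hfs hΔ
  -- casts of the rational side conditions
  have hκA0 : (0 : ℝ) ≤ ((κA : ℚ) : ℝ) := by exact_mod_cast hκA
  have hκA0' : (0 : ℝ) ≤ ((κA' : ℚ) : ℝ) := by exact_mod_cast hκA'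
  have hκB0 : (0 : ℝ) ≤ ((κB : ℚ) : ℝ) := by exact_mod_cast hκB
  have hκB0' : (0 : ℝ) ≤ ((κB' : ℚ) : ℝ) := by exact_mod_cast hκB'
  have hΔκ : (((κA - κA' - (κB - κB') : ℚ)) : ℝ) =
      ((κA : ℚ) : ℝ) - ((κA' : ℚ) : ℝ) - (((κB : ℚ) : ℝ) - ((κB' : ℚ) : ℝ)) := by push_cast; ring
  have hdR : ((((κB - κA) * (cB - cA) - (κB' - κA') * (flB - flA) : ℚ)) : ℝ) =
      (((κB : ℚ) : ℝ) - ((κA : ℚ) : ℝ)) * (((cB : ℚ) : ℝ) - ((cA : ℚ) : ℝ)) -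
        (((κB' : ℚ) : ℝ) - ((κA' : ℚ) : ℝ)) * (((flB : ℚ) : ℝ) - ((flA : ℚ) : ℝ)) := by push_cast; ring
  generalize hDdef : (((κA - κA' - (κB - κB') : ℚ)) : ℝ) = D at hL hΔκ
  generalize hddef : ((((κB - κA) * (cB - cA) - (κB' - κA') * (flB - flA) : ℚ)) : ℝ) = dR at hL hdR
  -- (1) COMBINED multipliers × COMBINED window slacks ≥ 0 (the bundle window `flo ≤ e ≤ cap` sits under / over the chords)
  have P1 : 0 ≤ ((1 - w) * ((κA : ℚ) : ℝ) + w * ((κB : ℚ) : ℝ)) * ((1 - w) * ((cA : ℚ) : ℝ) + w * ((cB : ℚ) : ℝ) - e) :=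
    mul_nonneg (add_nonneg (mul_nonneg h1w hκA0) (mul_nonneg hw0 hκB0)) (by linarith)
  have P2 : 0 ≤ ((1 - w) * ((κA' : ℚ) : ℝ) + w * ((κB' : ℚ) : ℝ)) * (e - ((1 - w) * ((flA : ℚ) : ℝ) + w * ((flB : ℚ) : ℝ))) :=
    mul_nonneg (add_nonneg (mul_nonneg h1w hκA0') (mul_nonneg hw0 hκB0')) (by linarith)
  -- (2) the covariance term, priced on the kinematic `K₂` row, plus the rhs covariance `dR`
  have hDK : |D * K| ≤ |D| * 1.6211390 := by
    rw [abs_mul]; exact mul_le_mul_of_nonneg_left hK (abs_nonneg _)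
  have h0 : -(|D| * (1.6211390 : ℝ)) ≤ D * K := by
    have := neg_abs_le (D * K)
    linarith
  have hcov1 : (sB - sA) * (-(|D| * (1.6211390 : ℝ))) ≤ (sB - sA) * (D * K) :=
    mul_le_mul_of_nonneg_left h0 hΔ.le
  have e1 : (sB - sA) * (-(|D| * (1.6211390 : ℝ))) = -((1.6211390 : ℝ) * (sB - sA) * |D|) := by ring
  have hcov0 : -((L : ℚ) : ℝ) ≤ (sB - sA) * (D * K) + dR := by linarith
  have hw01 : 0 ≤ w * (1 - w) := mul_nonneg hw0 h1w
  have hcov2 : w * (1 - w) * (-((L : ℚ) : ℝ)) ≤ w * (1 - w) * ((sB - sA) * (D * K) + dR) :=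
    mul_le_mul_of_nonneg_left hcov0 hw01
  have e2 : w * (1 - w) * (-((L : ℚ) : ℝ)) = -(w * (1 - w) * ((L : ℚ) : ℝ)) := by ring
  have P5 : -(w * (1 - w) * ((L : ℚ) : ℝ)) ≤ w * (1 - w) * ((sB - sA) * (D * K) + dR) := by linarith
  -- (3) the combined filling slope dominates the `min`
  have P6 : min (((slA : ℚ) : ℝ) * (x - ((n₀ : ℚ) : ℝ))) (((slB : ℚ) : ℝ) * (x - ((n₀ : ℚ) : ℝ))) ≤
      (1 - w) * (((slA : ℚ) : ℝ) * (x - ((n₀ : ℚ) : ℝ))) + w * (((slB : ℚ) : ℝ) * (x - ((n₀ : ℚ) : ℝ))) := by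
    have a1 := mul_le_mul_of_nonneg_left (min_le_left (((slA : ℚ) : ℝ) * (x - ((n₀ : ℚ) : ℝ)))
      (((slB : ℚ) : ℝ) * (x - ((n₀ : ℚ) : ℝ)))) h1w
    have a2 := mul_le_mul_of_nonneg_left (min_le_right (((slA : ℚ) : ℝ) * (x - ((n₀ : ℚ) : ℝ)))
      (((slB : ℚ) : ℝ) * (x - ((n₀ : ℚ) : ℝ)))) hw0
    linarith
  have P7 := hF w ⟨hw0, hw1⟩  -- (4) the slot under the Bernstein floor; (5) the barycentric combination:
  have hVA' := mul_le_mul_of_nonneg_left hVA h1w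
  have hVB' := mul_le_mul_of_nonneg_left hVB hw0
  have hEw : (1 - w) * (a₀ + sA * a₁) + w * (a₀ + sB * a₁) = 0 := by
    have hs' : (1 - w) * sA + w * sB = s := by linarith
    calc (1 - w) * (a₀ + sA * a₁) + w * (a₀ + sB * a₁)
        = a₀ + ((1 - w) * sA + w * sB) * a₁ := by ring
      _ = 0 := by rw [hs']; exact hE
  have key :
      (1 - w) * (((βA : ℚ) : ℝ) + ((κA : ℚ) : ℝ) * (((cA : ℚ) : ℝ) - (e + -(w * (sB - sA)) * K)) +
          ((κA' : ℚ) : ℝ) * (e + -(w * (sB - sA)) * K - ((flA : ℚ) : ℝ)) +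
          ((slA : ℚ) : ℝ) * (x - ((n₀ : ℚ) : ℝ)) + a₀ + sA * a₁) +
        w * (((βB : ℚ) : ℝ) + ((κB : ℚ) : ℝ) * (((cB : ℚ) : ℝ) - (e + (1 - w) * (sB - sA) * K)) +
          ((κB' : ℚ) : ℝ) * (e + (1 - w) * (sB - sA) * K - ((flB : ℚ) : ℝ)) +
          ((slB : ℚ) : ℝ) * (x - ((n₀ : ℚ) : ℝ)) + a₀ + sB * a₁) =
      ((1 - w) * ((βA : ℚ) : ℝ) + w * ((βB : ℚ) : ℝ)) +
        ((1 - w) * (((slA : ℚ) : ℝ) * (x - ((n₀ : ℚ) : ℝ))) + w * (((slB : ℚ) : ℝ) * (x - ((n₀ : ℚ) : ℝ)))) +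
        (((1 - w) * ((κA : ℚ) : ℝ) + w * ((κB : ℚ) : ℝ)) * ((1 - w) * ((cA : ℚ) : ℝ) + w * ((cB : ℚ) : ℝ) - e) +
          ((1 - w) * ((κA' : ℚ) : ℝ) + w * ((κB' : ℚ) : ℝ)) * (e - ((1 - w) * ((flA : ℚ) : ℝ) + w * ((flB : ℚ) : ℝ)))) +
        w * (1 - w) * ((sB - sA) * ((((κA : ℚ) : ℝ) - ((κA' : ℚ) : ℝ) - (((κB : ℚ) : ℝ) - ((κB' : ℚ) : ℝ))) * K) +
          ((((κB : ℚ) : ℝ) - ((κA : ℚ) : ℝ)) * (((cB : ℚ) : ℝ) - ((cA : ℚ) : ℝ)) -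
            (((κB' : ℚ) : ℝ) - ((κA' : ℚ) : ℝ)) * (((flB : ℚ) : ℝ) - ((flA : ℚ) : ℝ)))) +
        ((1 - w) * (a₀ + sA * a₁) + w * (a₀ + sB * a₁)) := by
    ring
  rw [← hΔκ, ← hdR] at key
  have hX : (1 - w) * Xbar + w * Xbar = Xbar := by ring
  unfold wnBundleValue
  linarith [hVA', hVB', key, hEw, hX, P1, P2, P5, P6, P7]

/-! ## §2 The reader's two floor kinds as corollaries (every side goal a rational inequality) -/

/-- **Interior kind, hub-anchored floor** (`0 < L`): `F ≤ β_A − (L − (β_B − β_A))²/(4L)` (`pinnedPair_segFloor_le`). [cite: BoydVandenberghe2004, §5.9] -/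
theorem TPrimePinnedPairRowWN.bundleWN_chord_interior
    (h : TPrimePinnedPairRowWN U sA sB cA cB flA flB βA κA κA' slA βB κB κB' slB n₀ X₀)
    (hU : 0 ≤ U) (hAB : sA < sB) (hκA : 0 ≤ κA) (hκA' : 0 ≤ κA') (hκB : 0 ≤ κB) (hκB' : 0 ≤ κB')
    {flo cap : ℝ → ℝ → ℝ}
    (hcap : ∀ s ∈ Set.Icc sA sB, (sB - sA) * cap U s ≤ (sB - s) * ((cA : ℚ) : ℝ) + (s - sA) * ((cB : ℚ) : ℝ))
    (hflo : ∀ s ∈ Set.Icc sA sB, (sB - s) * ((flA : ℚ) : ℝ) + (s - sA) * ((flB : ℚ) : ℝ) ≤ (sB - sA) * flo U s)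
    {F L : ℚ}
    (hL₁ : (1.6211390 : ℝ) * (sB - sA) * (((κA - κA' - (κB - κB') : ℚ)) : ℝ) -
      ((((κB - κA) * (cB - cA) - (κB' - κA') * (flB - flA) : ℚ)) : ℝ) ≤ ((L : ℚ) : ℝ))
    (hL₂ : (1.6211390 : ℝ) * (sB - sA) * -(((κA - κA' - (κB - κB') : ℚ)) : ℝ) -
      ((((κB - κA) * (cB - cA) - (κB' - κA') * (flB - flA) : ℚ)) : ℝ) ≤ ((L : ℚ) : ℝ))
    (hL0 : 0 < L) (hF : F ≤ βA - (L - (βB - βA)) ^ 2 / (4 * L)) :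
    SquareTTPrimeBundleOrbitLowerRowWN U U sA sB flo cap F slA slB n₀ Finset.univ (Literature.Probability.LatticeModels.box 2 7) X₀ := by
  refine h.bundleWN_chord hU hAB hκA hκA' hκB hκB' hcap hflo hL₁ hL₂ fun w _ => ?_
  have hF' : ((F : ℚ) : ℝ) ≤ ((βA : ℚ) : ℝ) - (((L : ℚ) : ℝ) - (((βB : ℚ) : ℝ) - ((βA : ℚ) : ℝ))) ^ 2 / (4 * ((L : ℚ) : ℝ)) := by
    have := (Rat.cast_le (K := ℝ)).2 hF
    push_cast at this
    exact this
  exact hF'.trans (pinnedPair_segFloor_le _ _ _ w (by exact_mod_cast hL0))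

/-- **Interior kind, spoke-anchored floor** (`0 < L`): `F ≤ β_B − (L − (β_A − β_B))²/(4L)`. [cite: BoydVandenberghe2004, §5.9] -/
theorem TPrimePinnedPairRowWN.bundleWN_chord_interior'
    (h : TPrimePinnedPairRowWN U sA sB cA cB flA flB βA κA κA' slA βB κB κB' slB n₀ X₀)
    (hU : 0 ≤ U) (hAB : sA < sB) (hκA : 0 ≤ κA) (hκA' : 0 ≤ κA') (hκB : 0 ≤ κB) (hκB' : 0 ≤ κB')
    {flo cap : ℝ → ℝ → ℝ}
    (hcap : ∀ s ∈ Set.Icc sA sB, (sB - sA) * cap U s ≤ (sB - s) * ((cA : ℚ) : ℝ) + (s - sA) * ((cB : ℚ) : ℝ))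
    (hflo : ∀ s ∈ Set.Icc sA sB, (sB - s) * ((flA : ℚ) : ℝ) + (s - sA) * ((flB : ℚ) : ℝ) ≤ (sB - sA) * flo U s)
    {F L : ℚ}
    (hL₁ : (1.6211390 : ℝ) * (sB - sA) * (((κA - κA' - (κB - κB') : ℚ)) : ℝ) -
      ((((κB - κA) * (cB - cA) - (κB' - κA') * (flB - flA) : ℚ)) : ℝ) ≤ ((L : ℚ) : ℝ))
    (hL₂ : (1.6211390 : ℝ) * (sB - sA) * -(((κA - κA' - (κB - κB') : ℚ)) : ℝ) -
      ((((κB - κA) * (cB - cA) - (κB' - κA') * (flB - flA) : ℚ)) : ℝ) ≤ ((L : ℚ) : ℝ))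
    (hL0 : 0 < L) (hF : F ≤ βB - (L - (βA - βB)) ^ 2 / (4 * L)) :
    SquareTTPrimeBundleOrbitLowerRowWN U U sA sB flo cap F slA slB n₀ Finset.univ (Literature.Probability.LatticeModels.box 2 7) X₀ := by
  refine h.bundleWN_chord hU hAB hκA hκA' hκB hκB' hcap hflo hL₁ hL₂ fun w _ => ?_
  have hF' : ((F : ℚ) : ℝ) ≤ ((βB : ℚ) : ℝ) - (((L : ℚ) : ℝ) - (((βA : ℚ) : ℝ) - ((βB : ℚ) : ℝ))) ^ 2 / (4 * ((L : ℚ) : ℝ)) := by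
    have := (Rat.cast_le (K := ℝ)).2 hF
    push_cast at this
    exact this
  have key := pinnedPair_segFloor_le ((βB : ℚ) : ℝ) ((βA : ℚ) : ℝ) ((L : ℚ) : ℝ) (1 - w) (by exact_mod_cast hL0)
  have e : (1 - (1 - w)) * ((βB : ℚ) : ℝ) + (1 - w) * ((βA : ℚ) : ℝ) - (1 - w) * (1 - (1 - w)) * ((L : ℚ) : ℝ) =
      (1 - w) * ((βA : ℚ) : ℝ) + w * ((βB : ℚ) : ℝ) - w * (1 - w) * ((L : ℚ) : ℝ) := by ring
  linarith

/-- **Vertex kind, hub below spoke** (`0 ≤ L`, `β_A + L ≤ β_B`): the floor is the hub bound, any `F ≤ β_A` (`tPrimePair_vertexFloor_le`) — the kind of the three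
Hg-1201 K2 reads j310371 / j311436 / j317048. [cite: BoydVandenberghe2004, §5.9] -/
theorem TPrimePinnedPairRowWN.bundleWN_chord_vertex
    (h : TPrimePinnedPairRowWN U sA sB cA cB flA flB βA κA κA' slA βB κB κB' slB n₀ X₀)
    (hU : 0 ≤ U) (hAB : sA < sB) (hκA : 0 ≤ κA) (hκA' : 0 ≤ κA') (hκB : 0 ≤ κB) (hκB' : 0 ≤ κB')
    {flo cap : ℝ → ℝ → ℝ}
    (hcap : ∀ s ∈ Set.Icc sA sB, (sB - sA) * cap U s ≤ (sB - s) * ((cA : ℚ) : ℝ) + (s - sA) * ((cB : ℚ) : ℝ))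
    (hflo : ∀ s ∈ Set.Icc sA sB, (sB - s) * ((flA : ℚ) : ℝ) + (s - sA) * ((flB : ℚ) : ℝ) ≤ (sB - sA) * flo U s)
    {F L : ℚ}
    (hL₁ : (1.6211390 : ℝ) * (sB - sA) * (((κA - κA' - (κB - κB') : ℚ)) : ℝ) -
      ((((κB - κA) * (cB - cA) - (κB' - κA') * (flB - flA) : ℚ)) : ℝ) ≤ ((L : ℚ) : ℝ))
    (hL₂ : (1.6211390 : ℝ) * (sB - sA) * -(((κA - κA' - (κB - κB') : ℚ)) : ℝ) -
      ((((κB - κA) * (cB - cA) - (κB' - κA') * (flB - flA) : ℚ)) : ℝ) ≤ ((L : ℚ) : ℝ))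
    (hL0 : 0 ≤ L) (hg : βA + L ≤ βB) (hF : F ≤ βA) :
    SquareTTPrimeBundleOrbitLowerRowWN U U sA sB flo cap F slA slB n₀ Finset.univ (Literature.Probability.LatticeModels.box 2 7) X₀ := by
  refine h.bundleWN_chord hU hAB hκA hκA' hκB hκB' hcap hflo hL₁ hL₂ fun w hw => ?_
  have hF' : ((F : ℚ) : ℝ) ≤ ((βA : ℚ) : ℝ) := by exact_mod_cast hF
  have hg' : ((βA : ℚ) : ℝ) + ((L : ℚ) : ℝ) ≤ ((βB : ℚ) : ℝ) := by exact_mod_cast hg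
  have hL0' : (0 : ℝ) ≤ ((L : ℚ) : ℝ) := by exact_mod_cast hL0
  have key := tPrimePair_vertexFloor_le ((βA : ℚ) : ℝ) ((βB : ℚ) : ℝ) ((L : ℚ) : ℝ) w hL0'
    (by rw [abs_of_nonneg (by linarith)]; linarith) hw.1 hw.2
  rw [min_eq_left (by linarith : ((βA : ℚ) : ℝ) ≤ ((βB : ℚ) : ℝ))] at key
  exact hF'.trans key

/-- **Vertex kind, spoke below hub** (`0 ≤ L`, `β_B + L ≤ β_A`): any `F ≤ β_B`. [cite: BoydVandenberghe2004, §5.9] -/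
theorem TPrimePinnedPairRowWN.bundleWN_chord_vertex'
    (h : TPrimePinnedPairRowWN U sA sB cA cB flA flB βA κA κA' slA βB κB κB' slB n₀ X₀)
    (hU : 0 ≤ U) (hAB : sA < sB) (hκA : 0 ≤ κA) (hκA' : 0 ≤ κA') (hκB : 0 ≤ κB) (hκB' : 0 ≤ κB')
    {flo cap : ℝ → ℝ → ℝ}
    (hcap : ∀ s ∈ Set.Icc sA sB, (sB - sA) * cap U s ≤ (sB - s) * ((cA : ℚ) : ℝ) + (s - sA) * ((cB : ℚ) : ℝ))
    (hflo : ∀ s ∈ Set.Icc sA sB, (sB - s) * ((flA : ℚ) : ℝ) + (s - sA) * ((flB : ℚ) : ℝ) ≤ (sB - sA) * flo U s)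
    {F L : ℚ}
    (hL₁ : (1.6211390 : ℝ) * (sB - sA) * (((κA - κA' - (κB - κB') : ℚ)) : ℝ) -
      ((((κB - κA) * (cB - cA) - (κB' - κA') * (flB - flA) : ℚ)) : ℝ) ≤ ((L : ℚ) : ℝ))
    (hL₂ : (1.6211390 : ℝ) * (sB - sA) * -(((κA - κA' - (κB - κB') : ℚ)) : ℝ) -
      ((((κB - κA) * (cB - cA) - (κB' - κA') * (flB - flA) : ℚ)) : ℝ) ≤ ((L : ℚ) : ℝ))
    (hL0 : 0 ≤ L) (hg : βB + L ≤ βA) (hF : F ≤ βB) :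
    SquareTTPrimeBundleOrbitLowerRowWN U U sA sB flo cap F slA slB n₀ Finset.univ (Literature.Probability.LatticeModels.box 2 7) X₀ := by
  refine h.bundleWN_chord hU hAB hκA hκA' hκB hκB' hcap hflo hL₁ hL₂ fun w hw => ?_
  have hF' : ((F : ℚ) : ℝ) ≤ ((βB : ℚ) : ℝ) := by exact_mod_cast hF
  have hg' : ((βB : ℚ) : ℝ) + ((L : ℚ) : ℝ) ≤ ((βA : ℚ) : ℝ) := by exact_mod_cast hg
  have hL0' : (0 : ℝ) ≤ ((L : ℚ) : ℝ) := by exact_mod_cast hL0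
  have key := tPrimePair_vertexFloor_le ((βA : ℚ) : ℝ) ((βB : ℚ) : ℝ) ((L : ℚ) : ℝ) w hL0'
    (by rw [abs_of_nonpos (by linarith)]; linarith) hw.1 hw.2
  rw [min_eq_right (by linarith : ((βB : ℚ) : ℝ) ≤ ((βA : ℚ) : ℝ))] at key
  exact hF'.trans key

end Law

/-! ## §3 Solver-free edges between the two bundle shapes (constant window literals) -/

section Edges
variable {U sA sB : ℝ} {lo hi F slA slB n₀ : ℚ} {X₀ : FermionOp (Literature.Probability.LatticeModels.box 2 7)}

/-- A window-function bundle row on `{U} × [s_A, s_B]` with CONSTANT functions `lo`, `hi` over `S = D₄`, `Λ = Λ₇` IS the constant-literal bundle row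
`TPrimeBundleOrbitLowerRowWN U s_A s_B lo hi F sl_A sl_B n₀ (fun _ ↦ X₀)` (definitional up to `U' ∈ [U, U] ↔ U' = U`). [folklore] -/
theorem TPrimeBundleOrbitLowerRowWN.of_squareBundle_const
    (h : SquareTTPrimeBundleOrbitLowerRowWN U U sA sB (fun _ _ => ((lo : ℚ) : ℝ)) (fun _ _ => ((hi : ℚ) : ℝ)) F slA slB n₀
      Finset.univ (Literature.Probability.LatticeModels.box 2 7) X₀) :
    TPrimeBundleOrbitLowerRowWN U sA sB lo hi F slA slB n₀ (fun _ => X₀) :=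
  fun s hs x hx0 hx2 ω Ls ψ hLs hψ h1 hω hlo hhi =>
    h U ⟨le_rfl, le_rfl⟩ s hs x hx0 hx2 ω Ls ψ hLs hψ h1 hω hlo hhi

/-- Conversely, the constant-literal bundle row gives the window-function bundle row for ANY functions inside the literals on the segment
(`lo ≤ flo U s`, `cap U s ≤ hi`). [folklore] -/
theorem TPrimeBundleOrbitLowerRowWN.squareBundle_of_window
    (h : TPrimeBundleOrbitLowerRowWN U sA sB lo hi F slA slB n₀ (fun _ => X₀)) {flo cap : ℝ → ℝ → ℝ}
    (hflo : ∀ s ∈ Set.Icc sA sB, ((lo : ℚ) : ℝ) ≤ flo U s) (hcap : ∀ s ∈ Set.Icc sA sB, cap U s ≤ ((hi : ℚ) : ℝ)) :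
    SquareTTPrimeBundleOrbitLowerRowWN U U sA sB flo cap F slA slB n₀ Finset.univ (Literature.Probability.LatticeModels.box 2 7) X₀ := by
  intro U' hU' s hs x hx0 hx2 ω Ls ψ hLs hψ h1 hω hl hc
  obtain rfl : U' = U := le_antisymm hU'.2 hU'.1
  exact h s hs x hx0 hx2 ω Ls ψ hLs hψ h1 hω ((hflo s hs).trans hl) (hc.trans (hcap s hs))

end Edges

end Summit.Ventures.CertifiedManyBodySolver.Downfold

end
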